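import Mathlib
import Summits.Ventures.PercRepro2.CoinFourAtomSandwich
import Summits.Ventures.PercRepro2.CoinKSureAD

/-!
# The four-atom sandwich on a core for MONOTONE {0,1}-valued markers
(blind cell PercRepro2, night-2 g17; proofs/NIGHT2-DARC.md §57.8)

`fourAtom_functional_nonneg_mono`: as `fourAtom_functional_nonneg'` (`CoinFourAtomPush.lean`) but
for ANY two markers `x, y : Finset V → R` with values in `{0, 1}` that are monotone under
inclusion — e.g. the entry indicator `1[W meets ent']` of an OR-vertex, or a point marker.  The
four functions theorem only needs the meet of a `10`-level and a `01`-level to be a `00`-level and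
their join a `11`-level, which monotonicity gives (`atom_lsm_mono`).  The engine of the chained
OR-vertex with the FIRST MARKER AT THE OR-VERTEX `a'` (`CoinChainMarkerA.lean`), where the
covering condition is automatic: a level missing `a'`'s entries cannot reach `a` through `a'`.
-/

namespace Summit.Ventures.PercRepro2.Coin

open Classical

section FourAtomMono

variable {V : Type*} [DecidableEq V] {R : Type*} [Field R] [LinearOrder R] [IsStrictOrderedRing R]

/-- The pushforward of a log-supermodular weight along two MONOTONE `{0,1}`-valued markers is
log-supermodular on the four atoms. -/
lemma atom_lsm_mono (U : Finset V) (F x y : Finset V → R) (hF0 : ∀ W, 0 ≤ F W)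
    (hF : ∀ s ⊆ U, ∀ t ⊆ U, F s * F t ≤ F (s ∩ t) * F (s ∪ t))
    (hx01 : ∀ W, x W = 0 ∨ x W = 1) (hy01 : ∀ W, y W = 0 ∨ y W = 1)
    (hxm : ∀ s t : Finset V, s ⊆ t → x s ≤ x t) (hym : ∀ s t : Finset V, s ⊆ t → y s ≤ y t) :
    (∑ W ∈ U.powerset, F W * (x W * (1 - y W))) * (∑ W ∈ U.powerset, F W * ((1 - x W) * y W)) ≤
    (∑ W ∈ U.powerset, F W * ((1 - x W) * (1 - y W))) * (∑ W ∈ U.powerset, F W * (x W * y W)) := by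
  have hx0 : ∀ W, 0 ≤ x W := fun W => by rcases hx01 W with h | h <;> simp [h]
  have hx1 : ∀ W, x W ≤ 1 := fun W => by rcases hx01 W with h | h <;> simp [h]
  have hy0 : ∀ W, 0 ≤ y W := fun W => by rcases hy01 W with h | h <;> simp [h]
  have hy1 : ∀ W, y W ≤ 1 := fun W => by rcases hy01 W with h | h <;> simp [h]
  refine ad_pointwise U _ _ _ _
    (fun W => mul_nonneg (hF0 W) (mul_nonneg (hx0 W) (by linarith [hy1 W])))
    (fun W => mul_nonneg (hF0 W) (mul_nonneg (by linarith [hx1 W]) (hy0 W)))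
    (fun W => mul_nonneg (hF0 W) (mul_nonneg (by linarith [hx1 W]) (by linarith [hy1 W])))
    (fun W => mul_nonneg (hF0 W) (mul_nonneg (hx0 W) (hy0 W))) ?_
  intro s hs t ht
  have h0 : 0 ≤ F (s ∩ t) * ((1 - x (s ∩ t)) * (1 - y (s ∩ t))) *
      (F (s ∪ t) * (x (s ∪ t) * y (s ∪ t))) :=
    mul_nonneg (mul_nonneg (hF0 _) (mul_nonneg (by linarith [hx1 (s ∩ t)])
      (by linarith [hy1 (s ∩ t)]))) (mul_nonneg (hF0 _) (mul_nonneg (hx0 _) (hy0 _)))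
  rcases hx01 s with hxs | hxs
  · rw [hxs]; simp only [zero_mul, mul_zero]; exact h0
  rcases hy01 s with hys | hys
  swap
  · rw [hys]; simp only [sub_self, mul_zero, zero_mul]; exact h0
  rcases hx01 t with hxt | hxt
  swap
  · rw [hxt]; simp only [sub_self, zero_mul, mul_zero]; exact h0
  rcases hy01 t with hyt | hyt
  · rw [hyt]; simp only [mul_zero]; exact h0
  -- the only non-trivial case: `m₁ ∈ s ∖ t`, `m₂ ∈ t ∖ s`
  have hxi : x (s ∩ t) = 0 := by
    rcases hx01 (s ∩ t) with h | h
    · exact h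
    · have := hxm (s ∩ t) t Finset.inter_subset_right; linarith
  have hyi : y (s ∩ t) = 0 := by
    rcases hy01 (s ∩ t) with h | h
    · exact h
    · have := hym (s ∩ t) s Finset.inter_subset_left; linarith
  have hxu : x (s ∪ t) = 1 := by
    rcases hx01 (s ∪ t) with h | h
    · have := hxm s (s ∪ t) Finset.subset_union_left; linarith
    · exact h
  have hyu : y (s ∪ t) = 1 := by
    rcases hy01 (s ∪ t) with h | h
    · have := hym t (s ∪ t) Finset.subset_union_right; linarith
    · exact h
  rw [hxs, hys, hxt, hyt, hxi, hyi, hxu, hyu]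
  simp only [sub_zero, mul_one]
  exact hF s hs t ht

/-- **THE FOUR-ATOM SANDWICH ON A CORE FOR MONOTONE `{0,1}` MARKERS.** `G` (the `R`-law) and
`G'` (the gate) nonnegative and log-supermodular on `U.powerset`, `G' ≤ G` on `U.powerset`, and
`G' = G` on every level of `U` where both markers vanish; `x, y` monotone with values in `{0, 1}`.
Then `Λ²M₁₁ − ΛΛ₁M₂ − ΛΛ₂M₁ + Λ₁Λ₂M ≥ 0`. -/
theorem fourAtom_functional_nonneg_mono (U : Finset V) (G G' x y : Finset V → R)
    (hG : ∀ W, 0 ≤ G W) (hG' : ∀ W, 0 ≤ G' W)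
    (hx01 : ∀ W, x W = 0 ∨ x W = 1) (hy01 : ∀ W, y W = 0 ∨ y W = 1)
    (hxm : ∀ s t : Finset V, s ⊆ t → x s ≤ x t) (hym : ∀ s t : Finset V, s ⊆ t → y s ≤ y t)
    (wLL : ∀ s ⊆ U, ∀ t ⊆ U, G s * G t ≤ G (s ∩ t) * G (s ∪ t))
    (wMM : ∀ s ⊆ U, ∀ t ⊆ U, G' s * G' t ≤ G' (s ∩ t) * G' (s ∪ t))
    (hle : ∀ W ∈ U.powerset, G' W ≤ G W)
    (h00 : ∀ W ∈ U.powerset, x W = 0 → y W = 0 → G' W = G W) :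
    0 ≤ (∑ W ∈ U.powerset, G W) ^ 2 * (∑ W ∈ U.powerset, G' W * (x W * y W))
        - (∑ W ∈ U.powerset, G W) * (∑ W ∈ U.powerset, G W * x W) *
          (∑ W ∈ U.powerset, G' W * y W)
        - (∑ W ∈ U.powerset, G W) * (∑ W ∈ U.powerset, G W * y W) *
          (∑ W ∈ U.powerset, G' W * x W)
        + (∑ W ∈ U.powerset, G W * x W) * (∑ W ∈ U.powerset, G W * y W) *
          (∑ W ∈ U.powerset, G' W) := by
  have hx0 : ∀ W, 0 ≤ x W := fun W => by rcases hx01 W with h | h <;> simp [h]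
  have hx1 : ∀ W, x W ≤ 1 := fun W => by rcases hx01 W with h | h <;> simp [h]
  have hy0 : ∀ W, 0 ≤ y W := fun W => by rcases hy01 W with h | h <;> simp [h]
  have hy1 : ∀ W, y W ≤ 1 := fun W => by rcases hy01 W with h | h <;> simp [h]
  -- the atom sums
  set r₀ := ∑ W ∈ U.powerset, G W * ((1 - x W) * (1 - y W)) with hr₀
  set r₁ := ∑ W ∈ U.powerset, G W * (x W * (1 - y W)) with hr₁
  set r₂ := ∑ W ∈ U.powerset, G W * ((1 - x W) * y W) with hr₂
  set r₁₂ := ∑ W ∈ U.powerset, G W * (x W * y W) with hr₁₂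
  set g₀ := ∑ W ∈ U.powerset, G' W * ((1 - x W) * (1 - y W)) with hg₀
  set g₁ := ∑ W ∈ U.powerset, G' W * (x W * (1 - y W)) with hg₁
  set g₂ := ∑ W ∈ U.powerset, G' W * ((1 - x W) * y W) with hg₂
  set g₁₂ := ∑ W ∈ U.powerset, G' W * (x W * y W) with hg₁₂
  have hr₀0 : 0 ≤ r₀ := Finset.sum_nonneg fun W _ =>
    mul_nonneg (hG W) (mul_nonneg (by linarith [hx1 W]) (by linarith [hy1 W]))
  have hr₁0 : 0 ≤ r₁ := Finset.sum_nonneg fun W _ =>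
    mul_nonneg (hG W) (mul_nonneg (hx0 W) (by linarith [hy1 W]))
  have hr₂0 : 0 ≤ r₂ := Finset.sum_nonneg fun W _ =>
    mul_nonneg (hG W) (mul_nonneg (by linarith [hx1 W]) (hy0 W))
  have hg₀0 : 0 ≤ g₀ := Finset.sum_nonneg fun W _ =>
    mul_nonneg (hG' W) (mul_nonneg (by linarith [hx1 W]) (by linarith [hy1 W]))
  have hg₁0 : 0 ≤ g₁ := Finset.sum_nonneg fun W _ =>
    mul_nonneg (hG' W) (mul_nonneg (hx0 W) (by linarith [hy1 W]))
  have hg₂0 : 0 ≤ g₂ := Finset.sum_nonneg fun W _ =>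
    mul_nonneg (hG' W) (mul_nonneg (by linarith [hx1 W]) (hy0 W))
  have hg₁₂0 : 0 ≤ g₁₂ := Finset.sum_nonneg fun W _ =>
    mul_nonneg (hG' W) (mul_nonneg (hx0 W) (hy0 W))
  have hr : r₁ * r₂ ≤ r₀ * r₁₂ := atom_lsm_mono U G x y hG wLL hx01 hy01 hxm hym
  have hg : g₁ * g₂ ≤ g₀ * g₁₂ := atom_lsm_mono U G' x y hG' wMM hx01 hy01 hxm hym
  have h0 : g₀ = r₀ := by
    refine Finset.sum_congr rfl fun W hW => ?_
    rcases hx01 W with h1 | h1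
    · rcases hy01 W with h2 | h2
      · rw [h00 W hW h1 h2]
      · rw [h2]; simp only [sub_self, mul_zero]
    · rw [h1]; simp only [sub_self, zero_mul, mul_zero]
  have h1 : g₁ ≤ r₁ := Finset.sum_le_sum fun W hW =>
    mul_le_mul_of_nonneg_right (hle W hW) (mul_nonneg (hx0 W) (by linarith [hy1 W]))
  have h2 : g₂ ≤ r₂ := Finset.sum_le_sum fun W hW =>
    mul_le_mul_of_nonneg_right (hle W hW) (mul_nonneg (by linarith [hx1 W]) (hy0 W))
  have key := fourAtom_sandwich r₀ r₁ r₂ r₁₂ g₀ g₁ g₂ g₁₂ hr₀0 hr₁0 hr₂0 hg₀0 hg₁0 hg₂0 hg₁₂0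
    hr hg h0 h1 h2
  have eΛ : (∑ W ∈ U.powerset, G W) = r₀ + r₁ + r₂ + r₁₂ := by
    simp only [hr₀, hr₁, hr₂, hr₁₂, ← Finset.sum_add_distrib]
    exact Finset.sum_congr rfl fun W _ => by ring
  have eΛ₁ : (∑ W ∈ U.powerset, G W * x W) = r₁ + r₁₂ := by
    simp only [hr₁, hr₁₂, ← Finset.sum_add_distrib]
    exact Finset.sum_congr rfl fun W _ => by ring
  have eΛ₂ : (∑ W ∈ U.powerset, G W * y W) = r₂ + r₁₂ := by
    simp only [hr₂, hr₁₂, ← Finset.sum_add_distrib]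
    exact Finset.sum_congr rfl fun W _ => by ring
  have eM : (∑ W ∈ U.powerset, G' W) = g₀ + g₁ + g₂ + g₁₂ := by
    simp only [hg₀, hg₁, hg₂, hg₁₂, ← Finset.sum_add_distrib]
    exact Finset.sum_congr rfl fun W _ => by ring
  have eM₁ : (∑ W ∈ U.powerset, G' W * x W) = g₁ + g₁₂ := by
    simp only [hg₁, hg₁₂, ← Finset.sum_add_distrib]
    exact Finset.sum_congr rfl fun W _ => by ring
  have eM₂ : (∑ W ∈ U.powerset, G' W * y W) = g₂ + g₁₂ := by
    simp only [hg₂, hg₁₂, ← Finset.sum_add_distrib]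
    exact Finset.sum_congr rfl fun W _ => by ring
  rw [eΛ, eΛ₁, eΛ₂, eM, eM₁, eM₂]
  unfold fourAtomT at key
  linarith [key]

end FourAtomMono

end Summit.Ventures.PercRepro2.Coin
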